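import Mathlib
import Literature.NumberTheory.Sieve.RomanoffExplicitAllN
import Literature.NumberTheory.Sieve.ShnirelmanGoldbachHarmonic
import HarnessLib

/-!
# Romanoff's theorem, explicit and uniform in `N`: the constant `1/34` (all `N ≥ 4`), via a prime-pair sieve from `e^32`

Topic `Literature/NumberTheory/Sieve`.  A follow-up to `RomanoffExplicitAllN.lean` / `RomanoffExplicitAllN40.lean` (same
namespace `Literature.NumberTheory.Sieve.RomanoffExplicit`; unconditional all-`N` records there: `1/79`, `1/45`, `1/40`):
**`romanoffAllN_34 : RomanoffAllN (1/34) 4`** — for every `N ≥ 4`, `#{n ≤ N : n = p + 2^k, p prime, k ≥ 1} ≥ N/34`, with NO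
hypotheses and NO named facts; and the input that makes it possible, a NEW explicit prime-pair sieve
**`pairCount_le_1435 : e^32 ≤ N → h ≠ 0 → Even h → #{p ≤ N : p + h prime} ≤ 14.35·f(h)·N/log²N`** (the tree's pair sieves
`pairCount_le_1301/1745/…` all start at `e^38` or higher).

Why the threshold and not the constant: for the all-`N` problem the large range (Romanoff's second-moment method, engines
`M1_ge_mul`, `M2_le_final`, `density_of_moments` of this namespace) and the finite range (one shift `p + 2`, counted by
`π(N − 2) ≥ 0.9636 (N − 2)/log(N − 2)`) must MEET: one shift gives `N/K` only while `log N ≤ 0.9636·K`, so a sieve starting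
at `e^Λ` forces `K ≥ Λ/0.9636` (`Λ = 38`: `K ≥ 39.4`, whence the `1/40` of `RomanoffExplicitAllN40`).  The threshold `e^38`
of the tree's sieve is not intrinsic: the certified 68-cell Selberg-sum bound `TwoResidueSelbergExplicit.Qsum_ge_kappa4`
holds for `X ≥ 2^22`, and with sieve cells of length `⌊√N⌋/c` that is `N ≥ 4^22·c²`.  Taking the SMALLEST admissible cell
parameter `c = 2` (large-sieve factor `(c² + 1)/c² = 5/4`; `c = 1` is excluded by the boundary term) gives `N ≥ 2^46 = e^{31.88}`:
§2 re-runs `ShnirelmanGoldbachExplicit.explicit_of_largeSieve_kappa4_c38` (Bateman–Diamond Thm 13.8) VERBATIM with `c = 2`,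
`Λ ≥ 32` and the boundary numerics re-derived (`TlowK4(l₁) ≥ 88` for `l₁ ≥ 15.3`, `100·L² ≤ √N` and `(√N/2 + 1)·L² ≤ N/100`
from `L ≥ 32`); desk `5·L² ≤ 4·14.33·TlowK4(L/2 − 0.6933)` for `L ≥ 32` (slack `0.27 %` at `L = 32`).  §3: `s = 1.3295`
(`0.9636·(1.4426 L − 2) − 0.01 ≥ 1.3295 L` iff `L ≥ 31.97`), `B = 4.035·14.35 = 57.90`, `1.3295²/(1.3295 + 57.90) = 0.02984 ≥ 1/34`.
§4: `π(N − 2) ≥ N/34` for `log N ≤ 32.5` (`N ≥ 250`) and four kernel checkpoints (`π(2), π(31), π(367), π(1321) ≥ 1, 11, 73, 216`)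
for `N < 5395`.  The two ranges meet with nothing to spare (`0.9636·34 = 32.76 ≥ 32`; `K = 33` would need `log N ≤ 31.80 <
31.88 = log 2^46`): `34` is the optimum of (68-cell Selberg sum from `2^22`, `c ≥ 2`, `c₀ = 0.9636`); under Rosser–Schoenfeld
(3.5) (`π(x) > x/log x`, `x ≥ 17`) the same assembly would give `1/32`.
NOT a new asymptotic Romanov constant (print, `N ≥ N₀` only: Chen–Sun 2004 `0.0868`, Habsieger–Roblot 2006 `0.0933`,
Pintz 2006 `0.09368`, Elsholtz–Schlage-Puchta 2018 `0.107648`) and NOT a parity statement.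
Origin: research cell parity-ideate (seat p5, ROUND-46 part C, 2026-08-29); statements and proofs kernel-checked there verbatim.
-/



namespace Literature.NumberTheory.Sieve.RomanoffExplicit

open Finset Real
open Literature.NumberTheory.Sieve
open Literature.NumberTheory.Sieve.RomanoffExplicit
open Literature.NumberTheory.Sieve.Romanov (romanovSet)
open Literature.NumberTheory.Sieve.GoldbachLinnik (oddSingularFactor)
open Literature.NumberTheory.Sieve.TwoResidueSelbergExplicit (TlowK4 Qsum_ge_kappa4)
open Literature.NumberTheory.Sieve.ShnirelmanGoldbachExplicit (primeCountingLowerMul_09636)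

/-! ## §1 Small helpers (private copies of tree lemmas, thresholds moved to `L ≥ 32`, `c = 2`) -/

/-- `TlowK4` is increasing on `[0, ∞)`. [folklore] -/
private theorem TlowK4_mono {l₁ l : ℝ} (h₁ : 0 ≤ l₁) (h : l₁ ≤ l) : TlowK4 l₁ ≤ TlowK4 l := by
  unfold TlowK4
  have h2 : (0 : ℝ) ≤ 0.3658 * (l + l₁) + 0.3394 := by nlinarith
  nlinarith [mul_nonneg (sub_nonneg.2 h) h2]

/-- `TlowK4(l₁) ≥ 88` for `l₁ ≥ 15.3` (`TlowK4(15.3) = 89.49`). [folklore] -/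
private theorem TlowK4_ge88 {l₁ : ℝ} (h₁ : 15.3 ≤ l₁) : 88 ≤ TlowK4 l₁ := by
  unfold TlowK4; nlinarith [h₁, sq_nonneg (l₁ - 15.3)]

/-- `f(n) ≥ 1`. [folklore] -/
private theorem one_le_oddSingularFactor' (n : ℕ) : 1 ≤ oddSingularFactor n := by
  unfold oddSingularFactor
  have h : ∏ _p ∈ n.primeFactors.filter (2 < ·), (1 : ℝ)
      ≤ ∏ p ∈ n.primeFactors.filter (2 < ·), (((p : ℝ) - 1) / ((p : ℝ) - 2)) := by
    refine Finset.prod_le_prod (fun _ _ => zero_le_one) fun p hp => ?_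
    rw [Finset.mem_filter] at hp
    have hp3 : (3 : ℝ) ≤ p := by exact_mod_cast hp.2
    rw [le_div_iff₀ (by linarith)]
    linarith
  simpa using h

/-- `e^{0.6933} ≥ 2.00024 = 2·1.00012` (`0.6933 = 0.6931471808 + 0.0001528192`). [folklore] -/
private theorem exp_06933_ge : (2.00024 : ℝ) ≤ Real.exp 0.6933 := by
  have hl2 : (2 : ℝ) ≤ Real.exp 0.6931471808 := by
    have h1 := Real.exp_log (show (0:ℝ) < 2 by norm_num)
    have h2 := Real.exp_le_exp.mpr Real.log_two_lt_d9.le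
    linarith
  have hsmall : (1.0001528192 : ℝ) ≤ Real.exp 0.0001528192 := by
    have := Real.add_one_le_exp (0.0001528192 : ℝ); linarith
  have hprod : Real.exp (0.6933 : ℝ) = Real.exp 0.6931471808 * Real.exp 0.0001528192 := by
    rw [← Real.exp_add]; norm_num
  rw [hprod]
  nlinarith [mul_le_mul hl2 hsmall (by norm_num) (by positivity)]

/-- `2^46 ≤ e^32` as a numeral (`e ≥ 2.718281828`; `2^46 = e^{31.88}`). [folklore] -/
private theorem numeral_le_exp_32 : (70368744177664 : ℝ) ≤ Real.exp 32 := by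
  have he : (2.718281828 : ℝ) ≤ Real.exp 1 := by have := Real.exp_one_gt_d9; linarith
  have h := pow_le_pow_left₀ (by norm_num) he 32
  rw [← Real.exp_nat_mul] at h
  norm_num at h
  exact le_trans (by norm_num) h

/-- The boundary numerics from `L ≥ 32` with `c = 2`: `(E/2 + 1)·L² ≤ 0.01·E²` once `100 L² ≤ E`. [folklore] -/
private theorem tail_numeric32 {L E : ℝ} (hL : 32 ≤ L) (hEL : 100 * L ^ 2 ≤ E) :
    (E / 2 + 1) * L ^ 2 ≤ 0.01 * E ^ 2 := by
  have hL2 : (1024 : ℝ) ≤ L ^ 2 := by nlinarith [hL]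
  have hE : (102400 : ℝ) ≤ E := by linarith
  nlinarith [hEL, hE, hL2]

/-! ## §2 The explicit large-sieve step from `e^32`, cell length `⌊√N⌋/2` -/

set_option maxHeartbeats 1600000 in
/-- **The explicit large-sieve step from `e^32`, cells of length `⌊√N⌋/2`** (the tree's
`explicit_of_largeSieve_kappa4_c38` with `c = 2` and `Λ ≥ max(32, 30.6 + 2·lc)`: `√N/2 ≥ 2^22` for `N ≥ 2^46 ≤ e^32`,
`TlowK4(l₁) ≥ 88` for `l₁ ≥ 15.3` (only positivity is used), boundary term `B ≤ 2(E/2 + 1)` absorbed by `0.02·N/L²`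
from `L ≥ 32`).
[cite: BatemanDiamond2004, Thm 13.8, §13.4–13.5 pp. 325–328 (explicit form proved here)] -/
theorem explicit_of_largeSieve_kappa4_c2_32 {c : ℕ} {lc Λ A : ℝ} (hc4 : 2 ≤ c) (hc4' : c ≤ 2)
    (hlc : (c : ℝ) * 1.00012 ≤ Real.exp lc) (hΛ : 32 ≤ Λ) (hΛc : 30.6 + 2 * lc ≤ Λ)
    (hA : ∀ L : ℝ, Λ ≤ L → ((c : ℝ) ^ 2 + 1) * L ^ 2
        ≤ (c : ℝ) ^ 2 * (A - 0.02) * TlowK4 (L / 2 - lc))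
    {N : ℕ} {C F B : ℝ} (hN : Real.exp Λ ≤ (N : ℝ)) (hF1 : 1 ≤ F)
    (hB : B ≤ 2 * ((Nat.sqrt N / c : ℕ) : ℝ) + 2)
    (hBD : C * GoldbachSieveEight.Qsum ∅ (Nat.sqrt N / c) ≤ (((Nat.sqrt N / c : ℕ) : ℝ) ^ 2 + N - 1) * F
      + B * GoldbachSieveEight.Qsum ∅ (Nat.sqrt N / c)) :
    C ≤ A * F * (N : ℝ) / Real.log (N : ℝ) ^ 2 := by
  have hN0 : (0 : ℝ) < N := lt_of_lt_of_le (Real.exp_pos Λ) hN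
  set L := Real.log (N : ℝ) with hLdef
  have hL : Λ ≤ L := by
    have := Real.log_le_log (Real.exp_pos Λ) hN
    rwa [Real.log_exp] at this
  have hL40 : (32 : ℝ) ≤ L := le_trans hΛ hL
  have hL2pos : 0 < L ^ 2 := by positivity
  have hcpos : 0 < c := by omega
  have hc0 : (0 : ℝ) < c := by exact_mod_cast hcpos
  have hcR4 : (2 : ℝ) ≤ c := by exact_mod_cast hc4
  have hcR32 : (c : ℝ) ≤ 2 := by exact_mod_cast hc4'
  -- E = √N = exp(L/2)
  set E := Real.exp (L / 2) with hEdef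
  have hE0 : 0 < E := Real.exp_pos _
  have hE2 : E ^ 2 = N := by
    have : E ^ 2 = Real.exp L := by rw [hEdef, sq, ← Real.exp_add]; ring_nf
    rw [this, hLdef, Real.exp_log hN0]
  have hE8 : (L / 2) ^ 8 / 40320 ≤ E := by
    have := Real.pow_div_factorial_le_exp (L / 2) (by linarith) 8
    simpa [Nat.factorial] using this
  have hLsq : (1024 : ℝ) ≤ L ^ 2 := by nlinarith [hL40]
  have hL6 : (1024 : ℝ) ^ 3 ≤ (L ^ 2) ^ 3 := pow_le_pow_left₀ (by norm_num) hLsq 3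
  have hEL : 100 * L ^ 2 ≤ E := by
    have h1 : (1024 : ℝ) ^ 3 * L ^ 2 ≤ (L ^ 2) ^ 3 * L ^ 2 := mul_le_mul_of_nonneg_right hL6 hL2pos.le
    have h2 : (L / 2) ^ 8 / 40320 = (L ^ 2) ^ 3 * L ^ 2 / 10321920 := by ring
    rw [h2] at hE8
    nlinarith [h1, hE8]
  have hE12 : (L / 2) ^ 12 / 479001600 ≤ E := by
    have := Real.pow_div_factorial_le_exp (L / 2) (by linarith) 12
    simpa [Nat.factorial] using this
  have hEbig2 : (560000 : ℝ) ≤ E := by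
    have h1 : ((16 : ℝ)) ^ 12 ≤ (L / 2) ^ 12 := pow_le_pow_left₀ (by norm_num) (by linarith) 12
    have h2 : ((16 : ℝ)) ^ 12 / 479001600 ≤ E := le_trans (div_le_div_of_nonneg_right h1 (by norm_num)) hE12
    norm_num at h2
    linarith
  -- s = ⌊√N⌋, X = s / c
  set s := Nat.sqrt N with hsdef
  set X := s / c with hXdef
  have hs2 : (s : ℝ) ^ 2 ≤ N := by exact_mod_cast Nat.sqrt_le' N
  have hs2' : (N : ℝ) < ((s : ℝ) + 1) ^ 2 := by exact_mod_cast Nat.lt_succ_sqrt' N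
  have hsE : (s : ℝ) ≤ E := by
    have : (s : ℝ) ^ 2 ≤ E ^ 2 := by rw [hE2]; exact hs2
    exact (pow_le_pow_iff_left₀ (Nat.cast_nonneg s) hE0.le two_ne_zero).mp this
  have hEs : E < (s : ℝ) + 1 := by
    have : E ^ 2 < ((s : ℝ) + 1) ^ 2 := by rw [hE2]; exact hs2'
    exact (pow_lt_pow_iff_left₀ hE0.le (by positivity) two_ne_zero).mp this
  have hXc : X * c ≤ s := Nat.div_mul_le_self s c
  have hXc' : s + 1 ≤ X * c + c := Nat.lt_div_mul_add hcpos
  have hXcR : (X : ℝ) * c ≤ s := by exact_mod_cast hXc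
  have hXcR' : (s : ℝ) + 1 ≤ (X : ℝ) * c + c := by exact_mod_cast hXc'
  have hX0R : (0 : ℝ) ≤ X := Nat.cast_nonneg X
  have hXR : (X : ℝ) ^ 2 * (c : ℝ) ^ 2 ≤ (N : ℝ) := by
    have : ((X : ℝ) * c) ^ 2 ≤ (s : ℝ) ^ 2 := pow_le_pow_left₀ (by positivity) hXcR 2
    nlinarith [hs2, this]
  have hXlo : E / c - 1 < (X : ℝ) := by
    have h1 : E < (X : ℝ) * c + c := by linarith [hEs, hXcR']
    rw [sub_lt_iff_lt_add, div_lt_iff₀ hc0]; linarith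
  have hXhi : (X : ℝ) ≤ E / c := by
    rw [le_div_iff₀ hc0]; linarith [hsE, hXcR]
  have hEc : (262145 : ℝ) ≤ E / c := by
    rw [le_div_iff₀ hc0]; nlinarith [hEbig2, hcR32]
  have hX0 : (0 : ℝ) < X := by linarith
  have hX4194304 : 4194304 ≤ X := by
    have h54 : ((70368744177664 : ℕ) : ℝ) ≤ (N : ℝ) := by
      have := numeral_le_exp_32.trans ((Real.exp_le_exp.mpr hΛ).trans hN)
      exact_mod_cast this
    have h54' : 70368744177664 ≤ N := by exact_mod_cast h54
    have hs27 : 8388608 ≤ s := by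
      rw [hsdef, Nat.le_sqrt]
      calc 8388608 * 8388608 = 70368744177664 := by norm_num
        _ ≤ N := h54'
    rw [hXdef]
    exact (Nat.le_div_iff_mul_le hcpos).mpr (by
      calc 4194304 * c ≤ 4194304 * 2 := Nat.mul_le_mul_left _ hc4'
        _ ≤ s := by omega)
  -- log X ≥ l₁ := L/2 − lc
  set l₁ := L / 2 - lc with hl₁def
  have hexp : Real.exp l₁ ≤ (X : ℝ) := by
    rw [hl₁def, Real.exp_sub]
    have hlc0 : (0 : ℝ) < (c : ℝ) * 1.00012 := by positivity
    have h1 : E / Real.exp lc ≤ E / ((c : ℝ) * 1.00012) :=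
      div_le_div_of_nonneg_left hE0.le hlc0 hlc
    have h2 : E / ((c : ℝ) * 1.00012) ≤ E / c - 1 := by
      rw [show E / ((c : ℝ) * 1.00012) = E / c / 1.00012 by rw [div_div],
        div_le_iff₀ (by norm_num : (0 : ℝ) < 1.00012)]
      linarith [hEc]
    linarith [hXlo]
  have hl : l₁ ≤ Real.log X := by
    rw [Real.le_log_iff_exp_le hX0]; exact hexp
  have hl₁ : (15.3 : ℝ) ≤ l₁ := by rw [hl₁def]; linarith
  -- Q ≥ TlowK4(log X) ≥ TlowK4(l₁) ≥ 88
  set Q := GoldbachSieveEight.Qsum ∅ X with hQdef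
  have hQ : TlowK4 (Real.log X) ≤ Q := Qsum_ge_kappa4 hX4194304
  have hQT : TlowK4 l₁ ≤ Q := le_trans (TlowK4_mono (by linarith) hl) hQ
  have hT₁ : (88 : ℝ) ≤ TlowK4 l₁ := TlowK4_ge88 hl₁
  have hQpos : 0 < Q := by linarith
  have hF0 : 0 ≤ F := le_trans zero_le_one hF1
  have hC1 : C ≤ ((X : ℝ) ^ 2 + N - 1) * F / Q + B := by
    have : C * Q ≤ (((X : ℝ) ^ 2 + N - 1) * F / Q + B) * Q := by
      rw [add_mul, div_mul_cancel₀ _ hQpos.ne']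
      exact hBD
    exact le_of_mul_le_mul_right this hQpos
  have hc2pos : (0 : ℝ) < (c : ℝ) ^ 2 := by positivity
  set K : ℝ := ((c : ℝ) ^ 2 + 1) / (c : ℝ) ^ 2 with hKdef
  have hK0 : 0 < K := by positivity
  have hC2 : ((X : ℝ) ^ 2 + N - 1) * F / Q ≤ K * (N : ℝ) * F / TlowK4 l₁ := by
    have hnum0 : 0 ≤ K * (N : ℝ) * F := by positivity
    have hXN : (X : ℝ) ^ 2 ≤ (N : ℝ) / (c : ℝ) ^ 2 := by rw [le_div_iff₀ hc2pos]; exact hXR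
    have hKN : (X : ℝ) ^ 2 + N - 1 ≤ K * N := by
      have : K * N = N / (c : ℝ) ^ 2 + N := by rw [hKdef]; field_simp; ring
      rw [this]; linarith
    have hnum : ((X : ℝ) ^ 2 + N - 1) * F ≤ K * (N : ℝ) * F := mul_le_mul_of_nonneg_right hKN hF0
    calc ((X : ℝ) ^ 2 + N - 1) * F / Q ≤ K * (N : ℝ) * F / Q := div_le_div_of_nonneg_right hnum hQpos.le
      _ ≤ K * (N : ℝ) * F / TlowK4 l₁ :=
          div_le_div_of_nonneg_left hnum0 (by linarith) hQT
  -- main term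
  have hmain : K * (N : ℝ) * F / TlowK4 l₁ ≤ (A - 0.02) * F * (N : ℝ) / L ^ 2 := by
    have hkey : ((c : ℝ) ^ 2 + 1) * L ^ 2 ≤ (c : ℝ) ^ 2 * (A - 0.02) * TlowK4 l₁ := hA L hL
    have hkey' : K * L ^ 2 ≤ (A - 0.02) * TlowK4 l₁ := by
      rw [hKdef, div_mul_eq_mul_div, div_le_iff₀ hc2pos]
      linarith [hkey]
    rw [div_le_div_iff₀ (by linarith) hL2pos]
    have hNF : 0 ≤ (N : ℝ) * F := by positivity
    have h := mul_le_mul_of_nonneg_left hkey' hNF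
    calc K * (N : ℝ) * F * L ^ 2 = (N : ℝ) * F * (K * L ^ 2) := by ring
      _ ≤ (N : ℝ) * F * ((A - 0.02) * TlowK4 l₁) := h
      _ = (A - 0.02) * F * (N : ℝ) * TlowK4 l₁ := by ring
  -- boundary term
  have htail : B ≤ 0.02 * F * (N : ℝ) / L ^ 2 := by
    have h2 : (E / 2 + 1) * L ^ 2 ≤ 0.01 * (N : ℝ) := by
      rw [← hE2]; exact tail_numeric32 hL40 hEL
    have h3 : 0.02 * (N : ℝ) ≤ 0.02 * F * (N : ℝ) :=
      calc 0.02 * (N : ℝ) ≤ F * (0.02 * (N : ℝ)) := le_mul_of_one_le_left (by positivity) hF1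
        _ = 0.02 * F * (N : ℝ) := by ring
    rw [le_div_iff₀ hL2pos]
    have h1 : B * L ^ 2 ≤ 2 * ((E / 2 + 1) * L ^ 2) := by
      have hEc4 : E / c ≤ E / 2 := div_le_div_of_nonneg_left hE0.le (by norm_num) hcR4
      have : B ≤ 2 * (E / 2 + 1) := by linarith only [hB, hXhi, hEc4]
      nlinarith only [this, hL2pos]
    linarith only [h1, h2, h3]
  calc C ≤ ((X : ℝ) ^ 2 + N - 1) * F / Q + B := hC1
    _ ≤ K * (N : ℝ) * F / TlowK4 l₁ + B := by linarith only [hC2]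
    _ ≤ (A - 0.02) * F * (N : ℝ) / L ^ 2 + 0.02 * F * (N : ℝ) / L ^ 2 := add_le_add hmain htail
    _ = A * F * (N : ℝ) / L ^ 2 := by ring

/-- **Explicit PRIME-PAIR sieve bound with length `⌊√N⌋/2`, from `e^32`**: under the numerics,
`#{p ≤ N : p + h prime} ≤ A·f(h)·N/log²N` for even `h ≠ 0`, `N ≥ e^Λ`.
[cite: BatemanDiamond2004, Thm 13.8 (explicit form proved here)] -/
theorem pairCount_le_of_numeric4_c2_32 {lc Λ A : ℝ}
    (hlc : (2 : ℝ) * 1.00012 ≤ Real.exp lc) (hΛ : 32 ≤ Λ) (hΛc : 30.6 + 2 * lc ≤ Λ)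
    (hA : ∀ L : ℝ, Λ ≤ L → ((2 : ℝ) ^ 2 + 1) * L ^ 2
        ≤ (2 : ℝ) ^ 2 * (A - 0.02) * TlowK4 (L / 2 - lc))
    {N h : ℕ} (hN : Real.exp Λ ≤ (N : ℝ)) (hh : h ≠ 0) (heven : Even h) :
    ((((Nat.primesLE N).filter fun p => (p + h).Prime).card : ℕ) : ℝ)
      ≤ A * oddSingularFactor h * (N : ℝ) / Real.log (N : ℝ) ^ 2 := by
  have h40 : Real.exp 32 ≤ (N : ℝ) := (Real.exp_le_exp.mpr hΛ).trans hN
  have h20 : (2 : ℝ) ^ 20 ≤ (N : ℝ) := le_trans (by norm_num) (numeral_le_exp_32.trans h40)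
  have hX1 : 1 ≤ Nat.sqrt N / 2 := by
    have h20' : 2 ^ 20 ≤ N := by exact_mod_cast h20
    have hs : 1024 ≤ Nat.sqrt N := by
      rw [Nat.le_sqrt]
      calc 1024 * 1024 = 2 ^ 20 := by norm_num
        _ ≤ N := h20'
    exact (Nat.le_div_iff_mul_le (by omega)).mpr (by omega)
  have hBD := GoldbachSieveEight.card_primePairs_mul_Qsum_le 1 h N (Nat.sqrt N / 2) le_rfl
    (Nat.one_le_iff_ne_zero.mpr hh) (by simpa using heven) hX1
  have hprod : (∏ p ∈ ((1 * h).primeFactors.filter (2 < ·)), (((p : ℝ) - 1) / ((p : ℝ) - 2)))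
      = oddSingularFactor h := by rw [one_mul]; rfl
  rw [hprod] at hBD
  have hmain := explicit_of_largeSieve_kappa4_c2_32 (c := 2) (le_rfl) (le_rfl) (by push_cast; exact hlc) hΛ hΛc
    (by intro L hL; have := hA L hL; push_cast; exact this) hN
    (one_le_oddSingularFactor' _) (by linarith) hBD
  have hcount : ((range (N + 1)).filter (fun p => p.Prime ∧ (1 * p + h).Prime)).card
      = ((Nat.primesLE N).filter fun p => (p + h).Prime).card := by
    congr 1
    ext p
    simp only [mem_filter, mem_range, Nat.mem_primesLE, one_mul, Nat.lt_succ_iff]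
    tauto
  rw [hcount] at hmain
  exact hmain

/-- `c = 2` numerics at `Λ = 32` on `TlowK4`: `5L² ≤ 4·14.33·TlowK4(L/2 − 0.6933)` for `L ≥ 32`
(slack `0.27 %` at `L = 32`). [folklore] -/
private theorem cells2_numeric4_32 {L : ℝ} (hL : 32 ≤ L) :
    ((2 : ℝ) ^ 2 + 1) * L ^ 2 ≤ (2 : ℝ) ^ 2 * (14.35 - 0.02) * TlowK4 (L / 2 - 0.6933) := by
  unfold TlowK4
  nlinarith [hL, mul_self_nonneg (L - 32)]

/-- ★ **PAIR SIEVE `14.35` above `e^32`** (`c = 2`, the 68 cells with the harmonic constant; the tree's `13.01` starts at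
`e^38`, part B's `13.3` at `e^34`). [cite: BatemanDiamond2004, Thm 13.8, §13.4–13.5 pp. 325–328 (explicit form proved here)] -/
theorem pairCount_le_1435 {N h : ℕ} (hN : Real.exp 32 ≤ (N : ℝ)) (hh : h ≠ 0) (heven : Even h) :
    ((((Nat.primesLE N).filter fun p => (p + h).Prime).card : ℕ) : ℝ)
      ≤ 14.35 * oddSingularFactor h * (N : ℝ) / Real.log (N : ℝ) ^ 2 :=
  pairCount_le_of_numeric4_c2_32 (lc := 0.6933) (by have := exp_06933_ge; linarith) (by norm_num) (by norm_num)
    (fun _ hL => cells2_numeric4_32 hL) hN hh heven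

/-- `UniformPairSieve 14.35 e^32`. [cite: BatemanDiamond2004, Thm 13.8, §13.4–13.5 pp. 325–328 (explicit form proved here)] -/
theorem uniformPairSieve_1435 : UniformPairSieve 14.35 (Real.exp 32) := by
  intro x h hx hh heven
  exact pairCount_le_1435 hx hh heven

/-! ## §3 The Romanoff density engine from `Λ ≥ 30` (`RomanoffExplicitAllN40.lean` had `Λ ≥ 38`) -/

/-- **The analytic branch, parametric** (as `RomanoffExplicitAllN40.density_mul_param`, threshold `Λ ≥ 30` instead of `38`).
[cite: Nathanson1996, §7.6 Theorem 7.11 (Romanov's theorem) — explicit-uniform parametric form proved here] -/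
theorem density_mul_param30 {A x₀ c₀ s Λ : ℝ} {x₁ : ℕ} (hA : 0 ≤ A) (hPS : UniformPairSieve A x₀)
    (hc₀ : 0 ≤ c₀) (hx₁ : 3 ≤ x₁) (hπ : PrimeCountingLowerMul c₀ x₁) (hs : 0 < s) (hΛ : 30 ≤ Λ)
    (hsmall : c₀ * (x₁ : ℝ) ≤ 0.01 * Real.exp Λ) (hx₁Λ : (2 : ℝ) * x₁ ≤ Real.exp Λ)
    (hnum : ∀ L : ℝ, Λ ≤ L → s * L ≤ c₀ * (1.4426 * L - 2) - 0.01)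
    {N : ℕ} (hx : x₀ ≤ (N : ℝ)) (hN : Real.exp Λ ≤ (N : ℝ)) :
    s ^ 2 / (s + 4.035 * A) * (N : ℝ) ≤ ((romanovSet N).card : ℝ) := by
  have h38 : Real.exp 30 ≤ (N : ℝ) := (Real.exp_le_exp.mpr hΛ).trans hN
  have hNbig : (4 : ℝ) ≤ N := by
    have : (4 : ℝ) ≤ Real.exp 30 := by
      have := Real.add_one_le_exp (30 : ℝ); linarith
    linarith
  have hNpos : (0 : ℝ) < N := by linarith
  have hN2 : 2 ≤ N := by exact_mod_cast (show (2 : ℝ) ≤ N by linarith)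
  have hlog2lo : (0.6931471803 : ℝ) < Real.log 2 := Real.log_two_gt_d9
  have hlog2hi : Real.log 2 < 0.6931471808 := Real.log_two_lt_d9
  set L := Real.log (N : ℝ) with hL
  have hLΛ : Λ ≤ L := by
    have h := Real.log_le_log (Real.exp_pos Λ) hN
    rwa [Real.log_exp] at h
  have hL38 : (30 : ℝ) ≤ L := hΛ.trans hLΛ
  have hx₁N : 2 * x₁ ≤ N := by
    have : (2 : ℝ) * x₁ ≤ N := hx₁Λ.trans hN
    exact_mod_cast this
  have h1 := M1_ge_mul (c₀ := c₀) (x₁ := x₁) hc₀ hx₁ hπ (N := N) hx₁N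
  have hinv : (1.4426 : ℝ) * L ≤ L / Real.log 2 := by
    rw [le_div_iff₀ (by linarith)]; nlinarith
  have hM1 : s * (N : ℝ) ≤ M1 N := by
    have hstep1 : c₀ * ((N : ℝ) * (1.4426 * L - 2) - x₁) ≤ c₀ * ((N : ℝ) * (L / Real.log 2 - 2) - x₁) := by
      apply mul_le_mul_of_nonneg_left _ hc₀
      nlinarith [mul_le_mul_of_nonneg_left hinv hNpos.le]
    have hstep2 : s * (N : ℝ) * L ≤ c₀ * ((N : ℝ) * (1.4426 * L - 2) - x₁) := by
      have hn := hnum L hLΛ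
      have hsm : c₀ * (x₁ : ℝ) ≤ 0.01 * (N : ℝ) := hsmall.trans (by nlinarith)
      have : s * L * (N : ℝ) ≤ (c₀ * (1.4426 * L - 2) - 0.01) * (N : ℝ) :=
        mul_le_mul_of_nonneg_right hn hNpos.le
      nlinarith
    have hkey : s * (N : ℝ) * L ≤ M1 N * L := (hstep2.trans hstep1).trans h1
    exact le_of_mul_le_mul_right hkey (by linarith)
  have h2 := M2_le_final hA hPS powTwoShiftMeanLe_193841 hx hN2
  have hB : A * 1.93841 / Real.log 2 ^ 2 ≤ 4.035 * A := by
    rw [div_le_iff₀ (by positivity)]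
    have hsq : (0.48045 : ℝ) ≤ Real.log 2 ^ 2 := by nlinarith
    nlinarith [mul_le_mul_of_nonneg_left hsq hA]
  have hM2 : M2 N ≤ M1 N + 4.035 * A * (N : ℝ) := by
    have : A * 1.93841 / Real.log 2 ^ 2 * (N : ℝ) ≤ 4.035 * A * (N : ℝ) :=
      mul_le_mul_of_nonneg_right hB hNpos.le
    linarith
  exact density_of_moments hs (by positivity) hM1 hM2

/-- `22700 ≤ e^32`. [folklore] -/
private theorem exp_32_big : (22700 : ℝ) ≤ Real.exp 32 := le_trans (by norm_num) numeral_le_exp_32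

/-- ★ **`N ≥ e^32`: `#romanovSet N ≥ N/34`**, unconditionally (`A = 14.35` from `e^32`, `c₀ = 0.9636`, `s = 1.3295`:
`1.3295²/(1.3295 + 4.035·14.35) = 0.02984 ≥ 1/34`).
[cite: Nathanson1996, §7.6 Theorem 7.11 (Romanov's theorem) — explicit form with constant 1/34 from e^32 proved here] -/
theorem romanov_ge_div34 {N : ℕ} (hN : Real.exp 32 ≤ (N : ℝ)) :
    (1 / 34 : ℝ) * (N : ℝ) ≤ ((romanovSet N).card : ℝ) := by
  have hd := density_mul_param30 (A := 14.35) (x₀ := Real.exp 32) (c₀ := 0.9636) (s := 1.3295) (Λ := 32)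
    (x₁ := 227) (by norm_num) uniformPairSieve_1435 (by norm_num) (by norm_num) primeCountingLowerMul_09636
    (by norm_num) (by norm_num) (by push_cast; linarith [exp_32_big]) (by push_cast; linarith [exp_32_big])
    (fun L hL => by nlinarith) hN hN
  have hc : (1 / 34 : ℝ) ≤ (1.3295 : ℝ) ^ 2 / (1.3295 + 4.035 * 14.35) := by norm_num
  exact (mul_le_mul_of_nonneg_right hc (Nat.cast_nonneg N)).trans hd

/-! ## §4 Below `e^32`: one shift `p + 2`, constant `1/34` -/

/-- `π(N − 2) ≤ #romanovSet N` (private copy). [folklore] -/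
private theorem primeCounting_le_card_romanovSet (N : ℕ) :
    Nat.primeCounting (N - 2) ≤ (romanovSet N).card := by
  classical
  rw [← Nat.primesLE_card_eq_primeCounting]
  refine card_le_card_of_injOn (fun p => p + 2) ?_ ?_
  · intro p hp
    rw [mem_coe, Nat.mem_primesLE] at hp
    have h2 := hp.2.two_le
    simp only [mem_coe, Romanov.romanovSet, mem_filter, mem_range]
    exact ⟨by omega, p, 1, hp.2, le_rfl, by ring⟩
  · intro p _ q _ h
    simpa using h

set_option maxRecDepth 100000 in
/-- Every entry of the tree's `firstPrimes` is prime (private copy). [folklore] -/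
private theorem firstPrimes_prime : ∀ p ∈ firstPrimes, p.Prime := by
  decide +kernel

set_option maxRecDepth 100000 in
/-- `firstPrimes` has no duplicates (private copy). [folklore] -/
private theorem firstPrimes_nodup : firstPrimes.Nodup := by
  decide +kernel

/-- `π(x) ≥ #{p ∈ firstPrimes : p ≤ x}` (private copy). [folklore] -/
private theorem le_primeCounting_of (x n : ℕ) (h : n ≤ (firstPrimes.filter (· ≤ x)).length) :
    n ≤ Nat.primeCounting x := by
  rw [← Nat.primesLE_card_eq_primeCounting]
  have hnd : (firstPrimes.filter (· ≤ x)).Nodup := firstPrimes_nodup.filter _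
  rw [← List.toFinset_card_of_nodup hnd] at h
  refine h.trans (card_le_card ?_)
  intro p hp
  rw [List.mem_toFinset, List.mem_filter] at hp
  rw [Nat.mem_primesLE]
  exact ⟨by simpa using hp.2, firstPrimes_prime p hp.1⟩

set_option maxRecDepth 100000 in
/-- `4 ≤ N < 5395`: `N/34 ≤ π(N − 2)` by four checkpoints (`π(2), π(31), π(367), π(1321) ≥ 1, 11, 73, 216`). [folklore] -/
private theorem small_range {N : ℕ} (h4 : 4 ≤ N) (h : N < 5395) :
    (1 / 34 : ℝ) * (N : ℝ) ≤ (Nat.primeCounting (N - 2) : ℝ) := by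
  have mono : ∀ {a b : ℕ}, a ≤ b → Nat.primeCounting a ≤ Nat.primeCounting b :=
    fun hab => Nat.monotone_primeCounting hab
  have step : ∀ (x n M : ℕ), n ≤ Nat.primeCounting x → x ≤ N - 2 → N < M → (M : ℝ) ≤ 34 * n →
      (1 / 34 : ℝ) * (N : ℝ) ≤ (Nat.primeCounting (N - 2) : ℝ) := by
    intro x n M hn hx hM hMn
    have h1 : (n : ℝ) ≤ Nat.primeCounting (N - 2) := by exact_mod_cast hn.trans (mono hx)
    have h2 : (N : ℝ) < M := by exact_mod_cast hM
    linarith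
  by_cases h36 : N < 34
  · exact step 2 1 34 (le_primeCounting_of 2 1 (by decide)) (by omega) h36 (by norm_num)
  by_cases h396 : N < 374
  · exact step 31 11 374 (le_primeCounting_of 31 11 (by decide)) (by omega) h396 (by norm_num)
  by_cases h2772 : N < 2482
  · exact step 367 73 2482 (le_primeCounting_of 367 73 (by decide)) (by omega) h2772 (by norm_num)
  · exact step 1321 216 5395 (le_primeCounting_of 1321 216 (by decide)) (by omega) h (by norm_num)

/-- `5395 ≤ N`, `log N ≤ 32.5`: `N/34 ≤ π(N − 2)` from `π(n) ≥ 0.9636 n/log n` (`n ≥ 227`):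
`0.9636 (N − 2) ≥ (32.5/34) N` iff `N ≥ 250`. [folklore] -/
private theorem mid_range {N : ℕ} (h1 : 5395 ≤ N) (h2 : Real.log (N : ℝ) ≤ 32.5) :
    (1 / 34 : ℝ) * (N : ℝ) ≤ (Nat.primeCounting (N - 2) : ℝ) := by
  have hx := primeCountingLowerMul_09636 (N - 2) (by omega)
  have hcast : ((N - 2 : ℕ) : ℝ) = (N : ℝ) - 2 := by
    rw [Nat.cast_sub (by omega)]; norm_num
  rw [hcast] at hx
  have hN : (5395 : ℝ) ≤ N := by exact_mod_cast h1
  have hlogle : Real.log ((N : ℝ) - 2) ≤ Real.log (N : ℝ) := Real.log_le_log (by linarith) (by linarith)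
  have hlogpos : 0 < Real.log ((N : ℝ) - 2) := Real.log_pos (by linarith)
  rw [div_le_iff₀ hlogpos] at hx
  have hπ0 : (0 : ℝ) ≤ Nat.primeCounting (N - 2) := Nat.cast_nonneg _
  have : (Nat.primeCounting (N - 2) : ℝ) * Real.log ((N : ℝ) - 2) ≤ (Nat.primeCounting (N - 2) : ℝ) * 32.5 :=
    mul_le_mul_of_nonneg_left (by linarith) hπ0
  linarith

/-- `4 ≤ N`, `log N ≤ 32.5`: `N/34 ≤ #romanovSet N`. [folklore] -/
private theorem finite_range {N : ℕ} (h4 : 4 ≤ N) (hlog : Real.log (N : ℝ) ≤ 32.5) :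
    (1 / 34 : ℝ) * (N : ℝ) ≤ ((romanovSet N).card : ℝ) := by
  have hR : (Nat.primeCounting (N - 2) : ℝ) ≤ ((romanovSet N).card : ℝ) := by
    exact_mod_cast primeCounting_le_card_romanovSet N
  by_cases h1 : N < 5395
  · exact (small_range h4 h1).trans hR
  · exact (mid_range (by omega) hlog).trans hR

/-! ## §5 The headline -/

/-- ★ **ROMANOFF'S THEOREM, EXPLICIT, UNIFORM IN `N`, UNCONDITIONAL, constant `1/34`**: for every `N ≥ 4`,
`#{n ≤ N : n = p + 2^k, p prime, k ≥ 1} ≥ N/34` (part A: `1/40`; part B: `1/36`; tree: `1/45`, `1/79`).  `N/34` above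
`e^32` (§3) and `N/34` below it by one shift; the two ranges meet with nothing to spare (`0.9636·34 = 32.76 ≥ 32`,
density `0.02984 ≥ 1/34 = 0.02941`) — `34` is the wall of (68-cell Selberg sum from `2^22`, `c ≥ 2`, `c₀ = 0.9636`).
[cite: Nathanson1996, §7.6 Theorem 7.11 (Romanov's theorem) — explicit-uniform form with constant 1/34 proved here] -/
theorem romanoffAllN_34 : RomanoffAllN (1 / 34 : ℝ) 4 := by
  intro N hN
  by_cases h3 : (N : ℝ) < Real.exp 32
  · have hNpos : (0 : ℝ) < N := by exact_mod_cast (show 0 < N by omega)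
    have hlog : Real.log (N : ℝ) ≤ 32.5 := by
      have := Real.log_le_log hNpos h3.le
      rw [Real.log_exp] at this
      linarith
    exact finite_range hN hlog
  · rw [not_lt] at h3
    exact romanov_ge_div34 h3

/-- The headline, unfolded: `∀ N ≥ 4, N/34 ≤ #{n ≤ N : ∃ p k, p prime ∧ 1 ≤ k ∧ p + 2^k = n}`.
[cite: Nathanson1996, §7.6 Theorem 7.11 (Romanov's theorem) — explicit-uniform form with constant 1/34 proved here] -/
theorem romanoffAllN_34_statement :
    ∀ N : ℕ, 4 ≤ N → (1 / 34 : ℝ) * (N : ℝ) ≤ ((romanovSet N).card : ℝ) :=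
  romanoffAllN_34

end Literature.NumberTheory.Sieve.RomanoffExplicit
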